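import Summits.Ventures.HodgeRepro2.T5SchurHilbert
import Mathlib.LinearAlgebra.Span.Basic

/-!
# T5SchurCentreRestrict — (A2)(ii)/(iv): restriction of an irreducible unitary representation along
`G = Z(G)·H`

Cell pub-hodge-repro2, seat p5, Tier 5 (route/T5-N4-p5.md, N4.3 (A2)(ii) and (iv), l. 145):
«Let π_∞ be an irreducible unitary representation of G_∞ on a (separable) Hilbert space V.  By
[Bo72] 5.4 l. 5 (the central character, from the Schur lemma of 5.4 l. 1), Z_∞ acts by a unitary
character, π_∞(z) = χ(z)·I.  Hence every closed G_∞^{ss}-invariant subspace of V is G_∞-invariant by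
(i), and π_∞|_{G_∞^{ss}} is an irreducible unitary representation of G_∞^{ss}.» and (iv): «Since Z_∞
acts on V by scalars, the K_∞-span and the K^{ss}-span of any vector coincide.»

Kernel forms (the central character is `T5SchurHilbert.exists_eq_smul_one_of_mem_center`; the
decomposition `G = Z(G)·H` of (A2)(i) is the hypothesis `∀ g, ∃ z ∈ center G, ∃ h ∈ H, g = z * h`):

* `stable_of_stable_subgroup`: a closed subspace stable under `ρ(H)` is stable under all of `ρ(G)`;
* `eq_bot_or_eq_top_of_stable_subgroup`: the restriction of an irreducible unitary `ρ` to `H` is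
  irreducible — (A2)(ii);
* `span_orbit_eq_span_orbit_subgroup`: the `ρ(G)`-span and the `ρ(H)`-span of a vector coincide, so
  `G`-finite vectors are `H`-finite vectors — (A2)(iv).

The earlier row 10 (T5AdmissibilityBookkeeping) states the same bookkeeping with «the centre acts by
scalars» as a HYPOTHESIS; here that hypothesis is discharged by Schur.  Mathlib only besides
`T5SchurHilbert`.  Axioms: propext, Classical.choice, Quot.sound.
-/

namespace Summit.Ventures.HodgeRepro2.T5SchurCentreRestrict

open ContinuousLinearMap

variable {E : Type*} [NormedAddCommGroup E] [InnerProductSpace ℂ E] [CompleteSpace E]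
variable {G : Type*} [Group G]

/-- For an irreducible unitary `ρ` and `G = Z(G)·H`, a closed subspace stable under `ρ(H)` is
stable under `ρ(G)`: `ρ(z h) w = χ(z) • ρ(h) w`. -/
theorem stable_of_stable_subgroup {ρ : G →* (E →L[ℂ] E)} (hρ : ∀ g, star (ρ g) = ρ g⁻¹)
    (hirr : ∀ W : Submodule ℂ E, IsClosed (W : Set E) →
      (∀ g, ∀ w ∈ W, ρ g w ∈ W) → W = ⊥ ∨ W = ⊤)
    (H : Subgroup G) (hG : ∀ g : G, ∃ z ∈ Subgroup.center G, ∃ h ∈ H, g = z * h)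
    {W : Submodule ℂ E} (hW : ∀ h ∈ H, ∀ w ∈ W, ρ h w ∈ W) (g : G) :
    ∀ w ∈ W, ρ g w ∈ W := by
  intro w hw
  obtain ⟨z, hz, h, hh, rfl⟩ := hG g
  obtain ⟨c, hc⟩ := T5SchurHilbert.exists_eq_smul_one_of_mem_center hρ hirr hz
  rw [map_mul, mul_apply_eq_comp, hc, smul_apply, one_apply_eq_self]
  exact W.smul_mem c (hW h hh w hw)

/-- **(A2)(ii).**  The restriction of an irreducible unitary representation `ρ` of `G` to a subgroup
`H` with `G = Z(G)·H` is irreducible: its closed stable subspaces are `⊥` and `⊤`. -/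
theorem eq_bot_or_eq_top_of_stable_subgroup {ρ : G →* (E →L[ℂ] E)}
    (hρ : ∀ g, star (ρ g) = ρ g⁻¹)
    (hirr : ∀ W : Submodule ℂ E, IsClosed (W : Set E) →
      (∀ g, ∀ w ∈ W, ρ g w ∈ W) → W = ⊥ ∨ W = ⊤)
    (H : Subgroup G) (hG : ∀ g : G, ∃ z ∈ Subgroup.center G, ∃ h ∈ H, g = z * h)
    (W : Submodule ℂ E) (hWc : IsClosed (W : Set E)) (hW : ∀ h ∈ H, ∀ w ∈ W, ρ h w ∈ W) :
    W = ⊥ ∨ W = ⊤ :=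
  hirr W hWc (stable_of_stable_subgroup hρ hirr H hG hW)

/-- **(A2)(iv).**  For an irreducible unitary `ρ` and `G = Z(G)·H`, the span of the `ρ(G)`-orbit of a
vector equals the span of its `ρ(H)`-orbit; in particular `G`-finite and `H`-finite vectors
coincide. -/
theorem span_orbit_eq_span_orbit_subgroup {ρ : G →* (E →L[ℂ] E)}
    (hρ : ∀ g, star (ρ g) = ρ g⁻¹)
    (hirr : ∀ W : Submodule ℂ E, IsClosed (W : Set E) →
      (∀ g, ∀ w ∈ W, ρ g w ∈ W) → W = ⊥ ∨ W = ⊤)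
    (H : Subgroup G) (hG : ∀ g : G, ∃ z ∈ Subgroup.center G, ∃ h ∈ H, g = z * h) (v : E) :
    Submodule.span ℂ (Set.range fun g : G => ρ g v) =
      Submodule.span ℂ (Set.range fun h : H => ρ (h : G) v) := by
  apply le_antisymm
  · rw [Submodule.span_le]
    rintro _ ⟨g, rfl⟩
    obtain ⟨z, hz, h, hh, rfl⟩ := hG g
    obtain ⟨c, hc⟩ := T5SchurHilbert.exists_eq_smul_one_of_mem_center hρ hirr hz
    simp only [map_mul, mul_apply_eq_comp, hc, smul_apply, one_apply_eq_self]
    exact Submodule.smul_mem _ c (Submodule.subset_span ⟨⟨h, hh⟩, rfl⟩)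
  · rw [Submodule.span_le]
    rintro _ ⟨h, rfl⟩
    exact Submodule.subset_span ⟨(h : G), rfl⟩

/-- The `ρ(G)`-orbit of a vector spans a finite-dimensional space iff its `ρ(H)`-orbit does
(`G = Z(G)·H`, `ρ` irreducible unitary). -/
theorem finiteDimensional_span_orbit_iff {ρ : G →* (E →L[ℂ] E)}
    (hρ : ∀ g, star (ρ g) = ρ g⁻¹)
    (hirr : ∀ W : Submodule ℂ E, IsClosed (W : Set E) →
      (∀ g, ∀ w ∈ W, ρ g w ∈ W) → W = ⊥ ∨ W = ⊤)
    (H : Subgroup G) (hG : ∀ g : G, ∃ z ∈ Subgroup.center G, ∃ h ∈ H, g = z * h) (v : E) :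
    FiniteDimensional ℂ (Submodule.span ℂ (Set.range fun g : G => ρ g v)) ↔
      FiniteDimensional ℂ (Submodule.span ℂ (Set.range fun h : H => ρ (h : G) v)) := by
  rw [span_orbit_eq_span_orbit_subgroup hρ hirr H hG v]

/-- **(A4)(2), the «W is Z_∞-stable hence G_∞-stable» sentence.**  For an irreducible unitary `ρ`
of `G` and subgroups `H ≤ G`, `G' ≤ G` with `G' ⊆ Z(G)·H` (e.g. `G' = G_∞ = Z_∞·G_∞^{ss}` inside
`G = G(𝔸)`), a closed subspace stable under `ρ(H)` is stable under `ρ(G')`. -/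
theorem stable_of_stable_subgroup' {ρ : G →* (E →L[ℂ] E)} (hρ : ∀ g, star (ρ g) = ρ g⁻¹)
    (hirr : ∀ W : Submodule ℂ E, IsClosed (W : Set E) →
      (∀ g, ∀ w ∈ W, ρ g w ∈ W) → W = ⊥ ∨ W = ⊤)
    (H G' : Subgroup G) (hG' : ∀ g ∈ G', ∃ z ∈ Subgroup.center G, ∃ h ∈ H, g = z * h)
    {W : Submodule ℂ E} (hW : ∀ h ∈ H, ∀ w ∈ W, ρ h w ∈ W) :
    ∀ g ∈ G', ∀ w ∈ W, ρ g w ∈ W := by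
  intro g hg w hw
  obtain ⟨z, hz, h, hh, rfl⟩ := hG' g hg
  obtain ⟨c, hc⟩ := T5SchurHilbert.exists_eq_smul_one_of_mem_center hρ hirr hz
  rw [map_mul, mul_apply_eq_comp, hc, smul_apply, one_apply_eq_self]
  exact W.smul_mem c (hW h hh w hw)

end Summit.Ventures.HodgeRepro2.T5SchurCentreRestrict
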